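import Mathlib
import HarnessLib
import Summits.HubbardSuperconductivity.HubbardSuperconductivity.Theorems.KLProgrammeForwardBubblePlanar

/-!
# Route `KLProgramme` — crux K3, ENGINE child (stmt-HubbardSuperconductivity-19855 `KLRegimeEngineV12`): the forward particle–hole slice bubble with a
# SECOND LINE OF ARBITRARY SHAPE — the transfer-shift estimate re-derived from the second propagator's JOINT LIPSCHITZ CONSTANT, and the
# per-ray / planar bounds on the frame band in that form (cell gate-hubbard-kl, seat hubbard-kl-k3c2-p2)

WHY.  `…MatsubaraSliceBubbleTransfer` / `…Window` / `…ForwardBubblePlanar` ask BOTH shell weights to vanish for `s ≤ (Λ_n/2)²` (same-slice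
pair).  In the Wick-ordered step (p1 g8, E2-STRUCTURE-NOTE §4, `…KLRegimeWickOrderedStep`) the rung is `g_n⊗g_n + g_n⊗D_n + D_n⊗g_n` with the SOFT
partner `D_n = C^K_{≤Λ_n}`, weight `d_n(s) = 1 − χ₂(s/Λ_n²)`, which has NO inner support radius.  Only the transfer shift is sensitive to this
(the zero-transfer weight `F = f·f'` inherits the inner radius from the FIRST line), and the shift needs only a joint Lipschitz constant `K'` of the
second propagator.  So the chain is re-derived with `K'` as an INPUT: §1 `klfs_shift_norm_le_of_lipschitz` (any jointly `K'`-Lipschitz `Ψ`: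
`≤ (256/π)·M_f·B_W·(K'Λ_n)·(|q₀|+δ_max)`, from `klsp_discrete_perturb_norm_le` + `klsp_count_factor_le`); §2 `klfs_transfer_norm_le_of_lipschitz`
(zero-transfer part by `klsw_slice_bubble_weighted_norm_le` on `F = f·f'` + §1, window hypotheses by clamping); §3 the `…ForwardBubblePlanar` twins
`klfs_ray_bubble_norm_le_of_lipschitz`, `klfs_planar_bubble_norm_le_of_lipschitz` on the frame band.  The soft-partner instance (`f' = d_n` cut off
below `(Λ_n/16)²` — legitimate because a slice-`n` first line and a below-resolution transfer force `s' ≥ (Λ_n/8)²`) is the companion module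
`…ForwardBubbleSoftPartner`.  Pure analysis; nothing about the model is asserted.
-/

noncomputable section

namespace Summit.HubbardSuperconductivity.HubbardSuperconductivity.Theorems.KLRegimeSplit

set_option linter.dupNamespace false -- summit = problem name (single-conjunct summit), D-0017

open Real Set Filter MeasureTheory intervalIntegral Complex Literature.MathematicalPhysics.QuantumLattice
open Literature.MathematicalPhysics.QuantumLattice.BandSectorCounting Literature.Probability.LatticeModels
open Summit.HubbardSuperconductivity.HubbardSuperconductivity.Theorems.PerturbedFermiCurve
open Summit.HubbardSuperconductivity.HubbardSuperconductivity.Theorems.KLProgrammeLegKernels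

/-! ## §1 The transfer shift from a joint Lipschitz constant of the second propagator -/

section Shift
variable {f : ℝ → ℂ} {Mf : ℝ} {Ψ : ℝ → ℝ → ℂ} {K' : ℝ} {W : ℝ → ℂ} {δ : ℝ → ℝ} {BW δmax : ℝ}

/-- **Transfer shift, second propagator abstract.**  First line: shell weight `f` at scale `n` (`‖f‖ ≤ M_f`, `f = 0` for `s ≤ (Λ_n/2)²` and for
`s ≥ (4Λ_n)²`), in the singularity-free form `Φ_f(k₀,e) = (f(s)/s)(ik₀+e)`; second line: ANY `Ψ : ℝ → ℝ → ℂ` jointly `K'`-Lipschitz; insertion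
`‖W‖ ≤ B_W` on `|e| < 4Λ_n`; shift `|δ| ≤ δ_max`; `β ≥ klBetaMin`, `n ≤ n_β + 1`, any `M`.  Then
`‖β⁻¹•Σ_i ∫ W(e)Φ_f(ω_i,e)(Ψ(ω_i+q₀, e+δ(e)) − Ψ(ω_i,e)) de‖ ≤ (256/π)·M_f·B_W·(K'·Λ_n)·(|q₀| + δ_max)`. -/
theorem klfs_shift_norm_le_of_lipschitz (hbd : ∀ s, ‖f s‖ ≤ Mf) {n : ℕ}
    (hin : ∀ s, s ≤ (klScale klE0 n / 2) ^ 2 → f s = 0) (hout : ∀ s, (4 * klScale klE0 n) ^ 2 ≤ s → f s = 0)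
    (hK' : 0 ≤ K') (hΨlip : ∀ k₀ e k₀' e', ‖Ψ k₀ e - Ψ k₀' e'‖ ≤ K' * (|k₀ - k₀'| + |e - e'|))
    (hBW : 0 ≤ BW) (hWbd : ∀ e, |e| < 4 * klScale klE0 n → ‖W e‖ ≤ BW) (hδ0 : 0 ≤ δmax) (hδ : ∀ e, |δ e| ≤ δmax)
    (q₀ : ℝ) {β : ℝ} (hβ : klBetaMin ≤ β) (hn : n ≤ nScales β + 1) (M : ℕ) :
    ‖β⁻¹ • ∑ i : MatsubaraIdx M, ∫ e,
        W e * klfb_prop f (matsubaraFreq β M i) e * (Ψ (matsubaraFreq β M i + q₀) (e + δ e) - Ψ (matsubaraFreq β M i) e)‖ ≤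
      256 / Real.pi * Mf * BW * (K' * klScale klE0 n) * (|q₀| + δmax) := by
  set Λ := klScale klE0 n with hΛdef
  have hΛ : 0 < Λ := klth_klScale_pos n
  have hβ0 : 0 < β := pos_of_klBetaMin_le hβ
  have hMf : 0 ≤ Mf := (norm_nonneg _).trans (hbd 0)
  have hr₁ : 0 < Λ / 2 := by positivity
  have hr : 0 < 4 * Λ := by positivity
  have hgsupp : ∀ s, (4 * Λ) ^ 2 ≤ s → (fun s : ℝ => f s / ((s : ℝ) : ℂ)) s = 0 := fun s hs => by simp only [hout s hs, zero_div]
  set A : ℝ := Mf / (Λ / 2) with hA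
  have hA0 : 0 ≤ A := by positivity
  set D : ℝ := |q₀| + δmax with hD
  have main := klsp_discrete_perturb_norm_le
    (Φ := fun k₀ e => f (k₀ ^ 2 + e ^ 2) / (((k₀ ^ 2 + e ^ 2 : ℝ)) : ℂ) * (I * k₀ + e)) (Ψ := Ψ) (W := W) (δ := δ)
    hA0 hK' hBW hr.le hδ0
    (fun k₀ e => klsp_div_propagator_norm_le hbd hin hr₁ k₀ e)
    (fun k₀ hk e => klsp_zero_of_le_abs_fst hgsupp hr.le hk e)
    (fun k₀ e he => klsp_zero_of_le_abs_snd hgsupp hr.le k₀ he)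
    hΨlip hWbd hδ q₀ hβ0 M
  have hform : (β⁻¹ • ∑ i : MatsubaraIdx M, ∫ e,
      W e * klfb_prop f (matsubaraFreq β M i) e * (Ψ (matsubaraFreq β M i + q₀) (e + δ e) - Ψ (matsubaraFreq β M i) e)) =
      β⁻¹ • ∑ i : MatsubaraIdx M, ∫ e, W e *
        (fun k₀ e => f (k₀ ^ 2 + e ^ 2) / (((k₀ ^ 2 + e ^ 2 : ℝ)) : ℂ) * (I * k₀ + e)) (matsubaraFreq β M i) e *
          (Ψ (matsubaraFreq β M i + q₀) (e + δ e) - Ψ (matsubaraFreq β M i) e) := by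
    simp only [klfb_prop]
  rw [hform]
  refine main.trans ?_
  have hcount := klsp_count_factor_le hβ hn
  rw [← hΛdef] at hcount
  calc (4 * Λ / Real.pi + 3 / β) * (2 * (4 * Λ) * (BW * A * (K' * D)))
      ≤ (16 / Real.pi * Λ) * (2 * (4 * Λ) * (BW * A * (K' * D))) :=
        mul_le_mul_of_nonneg_right hcount (by positivity)
    _ = 256 / Real.pi * Mf * BW * (K' * Λ) * D := by
        rw [hA]; field_simp; ring
end Shift

/-! ## §2 The bubble at transfer: zero-transfer part + shift, window hypotheses -/

section Transfer
variable {f f' : ℝ → ℂ} {Lf Mf LF MF ℓ K' : ℝ} {W : ℝ → ℂ} {σ : ℝ → ℝ} {LW BW δmax : ℝ}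

/-- Continuity in `e` of a jointly Lipschitz `Ψ(k₀, ·)`. -/
theorem klfs_continuous_snd_of_lipschitz {Ψ : ℝ → ℝ → ℂ} {K' : ℝ}
    (hΨlip : ∀ k₀ e k₀' e', ‖Ψ k₀ e - Ψ k₀' e'‖ ≤ K' * (|k₀ - k₀'| + |e - e'|)) (k₀ : ℝ) : Continuous fun e => Ψ k₀ e := by
  have hK : 0 ≤ K' := by
    have h := hΨlip 0 1 0 0
    norm_num at h; linarith [norm_nonneg (Ψ 0 1 - Ψ 0 0)]
  have hl : LipschitzWith (Real.toNNReal K') (fun e : ℝ => Ψ k₀ e) :=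
    LipschitzWith.of_dist_le_mul fun e e' => by
      rw [dist_eq_norm, Real.dist_eq, Real.coe_toNNReal _ hK]
      have h := hΨlip k₀ e k₀ e'
      rwa [sub_self, abs_zero, zero_add] at h
  exact hl.continuous

/-- **The slice bubble AT TRANSFER with the second line given by its joint Lipschitz constant (global form).**  As
`klsp_slice_bubble_transfer_norm_le` but the second weight `f'` is only asked to make `Φ_{f'}` jointly `K'`-Lipschitz (no support / no own
Lipschitz hypothesis); the product `F = f·f'` carries the zero-transfer hypotheses (`‖F‖ ≤ M_F`, `Lip F ≤ ℓ/Λ_n²`; its support comes from `f`);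
`W` continuous with `‖W(e) − W(0)‖ ≤ L_W|e|`, `‖W‖ ≤ B_W` on `|e| < 4Λ_n`; shift `σ` continuous, `|σ| ≤ δ_max`. -/
theorem klfs_transfer_norm_le_of_lipschitz_core
    (hlip : ∀ s s', ‖f s - f s'‖ ≤ Lf * |s - s'|) (hbd : ∀ s, ‖f s‖ ≤ Mf) {n : ℕ}
    (hin : ∀ s, s ≤ (klScale klE0 n / 2) ^ 2 → f s = 0) (hout : ∀ s, (4 * klScale klE0 n) ^ 2 ≤ s → f s = 0)
    (hK' : 0 ≤ K') (hΨlip : ∀ k₀ e k₀' e', ‖klfb_prop f' k₀ e - klfb_prop f' k₀' e'‖ ≤ K' * (|k₀ - k₀'| + |e - e'|))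
    (hMF : 0 ≤ MF) (hFlip : ∀ s s', ‖f s * f' s - f s' * f' s'‖ ≤ LF * |s - s'|) (hFbd : ∀ s, ‖f s * f' s‖ ≤ MF)
    (hLF : LF ≤ ℓ / klScale klE0 n ^ 2)
    (hW : Continuous W) (hLW : 0 ≤ LW) (hBW : 0 ≤ BW)
    (hWlip : ∀ e : ℝ, |e| < 4 * klScale klE0 n → ‖W e - W 0‖ ≤ LW * |e|)
    (hWbd : ∀ e, |e| < 4 * klScale klE0 n → ‖W e‖ ≤ BW)
    (hσc : Continuous σ) (hδ0 : 0 ≤ δmax) (hσ : ∀ e, |σ e| ≤ δmax)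
    (q₀ : ℝ) {β : ℝ} (hβ : klBetaMin ≤ β) (hn : n ≤ nScales β + 1) {M : ℕ}
    (hM : β * (4 * klScale klE0 n) / (2 * Real.pi) + 1 ≤ M) :
    ‖β⁻¹ • ∑ i : MatsubaraIdx M, ∫ e,
        W e * klfb_prop f (matsubaraFreq β M i) e * klfb_prop f' (matsubaraFreq β M i + q₀) (e + σ e)‖ ≤
      524288 / Real.pi * (ℓ + 8 * MF) * LW * klScale klE0 n +
        393216 / Real.pi * (ℓ + 8 * MF) * BW * ((Real.pi / β) / klScale klE0 n) +
          256 / Real.pi * Mf * BW * (K' * klScale klE0 n) * (|q₀| + δmax) := by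
  set Λ := klScale klE0 n with hΛdef
  have hΛ : 0 < Λ := klth_klScale_pos n
  have hr₁ : 0 < Λ / 2 := by positivity
  have hr : 0 < 4 * Λ := by positivity
  set ω : MatsubaraIdx M → ℝ := fun i => matsubaraFreq β M i with hω
  -- continuity in `e` of the factors
  have hΦc : ∀ k₀, Continuous fun e => klfb_prop f k₀ e := fun k₀ => klfb_continuous_prop_snd hlip hbd hin hout hr₁ hr k₀
  have hΨc : ∀ k₀, Continuous fun e => klfb_prop f' k₀ e := fun k₀ => klfs_continuous_snd_of_lipschitz hΨlip k₀
  have hΨsc : ∀ k₀, Continuous fun e => klfb_prop f' (k₀ + q₀) (e + σ e) := fun k₀ =>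
    (hΨc (k₀ + q₀)).comp (continuous_id.add hσc)
  have hΦzero : ∀ k₀ e, 4 * Λ ≤ |e| → klfb_prop f k₀ e = 0 := fun k₀ e he => klfb_prop_eq_zero_of_le_abs hr.le hout k₀ he
  -- integrability of the two pieces of each slice
  have hint1 : ∀ k₀ : ℝ, Integrable fun e : ℝ => W e * klfb_prop f k₀ e * klfb_prop f' k₀ e := by
    intro k₀
    have hcont : Continuous fun e : ℝ => W e * klfb_prop f k₀ e * klfb_prop f' k₀ e := (hW.mul (hΦc k₀)).mul (hΨc k₀)
    refine hcont.integrable_of_hasCompactSupport ?_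
    refine HasCompactSupport.intro (isCompact_Icc (a := -(4 * Λ)) (b := 4 * Λ)) fun e he => ?_
    rw [hΦzero k₀ e (klsp_le_abs_of_not_mem_Icc he), mul_zero, zero_mul]
  have hint2 : ∀ k₀ : ℝ, Integrable fun e : ℝ =>
      W e * klfb_prop f k₀ e * (klfb_prop f' (k₀ + q₀) (e + σ e) - klfb_prop f' k₀ e) := by
    intro k₀
    have hcont : Continuous fun e : ℝ => W e * klfb_prop f k₀ e * (klfb_prop f' (k₀ + q₀) (e + σ e) - klfb_prop f' k₀ e) :=
      (hW.mul (hΦc k₀)).mul ((hΨsc k₀).sub (hΨc k₀))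
    refine hcont.integrable_of_hasCompactSupport ?_
    refine HasCompactSupport.intro (isCompact_Icc (a := -(4 * Λ)) (b := 4 * Λ)) fun e he => ?_
    rw [hΦzero k₀ e (klsp_le_abs_of_not_mem_Icc he), mul_zero, zero_mul]
  -- split each slice
  have hsplit : ∀ i : MatsubaraIdx M,
      (∫ e, W e * klfb_prop f (ω i) e * klfb_prop f' (ω i + q₀) (e + σ e)) =
        (∫ e, W e * klfb_prop f (ω i) e * klfb_prop f' (ω i) e) +
          ∫ e, W e * klfb_prop f (ω i) e * (klfb_prop f' (ω i + q₀) (e + σ e) - klfb_prop f' (ω i) e) := by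
    intro i
    rw [← integral_add (hint1 (ω i)) (hint2 (ω i))]
    refine integral_congr_ae (Filter.Eventually.of_forall fun e => ?_)
    simp only
    ring
  -- the zero-transfer integrand in the carrier's form
  have hzero_form : ∀ (k₀ e : ℝ), W e * klfb_prop f k₀ e * klfb_prop f' k₀ e =
      (f (k₀ ^ 2 + e ^ 2) * f' (k₀ ^ 2 + e ^ 2)) * ((-I * k₀ + e) ^ 2)⁻¹ * W e := by
    intro k₀ e
    simp only [klfb_prop]
    rw [klsp_div_propagator_eq f k₀ e, klsp_div_propagator_eq f' k₀ e]
    rw [show ((-I * (k₀ : ℂ) + e) ^ 2)⁻¹ = (-I * k₀ + e)⁻¹ * (-I * k₀ + e)⁻¹ by rw [sq, mul_inv]]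
    ring
  have hsum : (β⁻¹ • ∑ i : MatsubaraIdx M, ∫ e, W e * klfb_prop f (ω i) e * klfb_prop f' (ω i + q₀) (e + σ e)) =
      β⁻¹ • (∑ i : MatsubaraIdx M, ∫ e, (f (ω i ^ 2 + e ^ 2) * f' (ω i ^ 2 + e ^ 2)) * ((-I * (ω i) + e) ^ 2)⁻¹ * W e) +
        β⁻¹ • ∑ i : MatsubaraIdx M, ∫ e,
          W e * klfb_prop f (ω i) e * (klfb_prop f' (ω i + q₀) (e + σ e) - klfb_prop f' (ω i) e) := by
    rw [← smul_add, ← Finset.sum_add_distrib]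
    congr 1
    refine Finset.sum_congr rfl fun i _ => ?_
    rw [hsplit i]
    congr 1
    refine integral_congr_ae (Filter.Eventually.of_forall fun e => ?_)
    exact hzero_form (ω i) e
  have h1 := klte_slice_bubble_weighted_norm_le (F := fun s => f s * f' s) (W := W) hMF hFlip hFbd hLF
    (fun s hs => by simp only [hin s hs, zero_mul]) (fun s hs => by simp only [hout s hs, zero_mul])
    hW hLW hBW hWlip hWbd hβ hn hM
  have h2 := klfs_shift_norm_le_of_lipschitz (Ψ := klfb_prop f') hbd hin hout hK' hΨlip hBW hWbd hδ0 hσ q₀ hβ hn M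
  change ‖β⁻¹ • ∑ i : MatsubaraIdx M, ∫ e, W e * klfb_prop f (ω i) e * klfb_prop f' (ω i + q₀) (e + σ e)‖ ≤ _
  rw [hsum]
  refine (norm_add_le _ _).trans ?_
  exact add_le_add h1 h2

/-- **Window form** of `klfs_transfer_norm_le_of_lipschitz_core`: `W` and the shift `σ` only continuous / bounded ON `[−4Λ_n, 4Λ_n]`
(clamping, as in `…MatsubaraSliceBubbleWindow`). -/
theorem klfs_transfer_norm_le_of_lipschitz
    (hlip : ∀ s s', ‖f s - f s'‖ ≤ Lf * |s - s'|) (hbd : ∀ s, ‖f s‖ ≤ Mf) {n : ℕ}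
    (hin : ∀ s, s ≤ (klScale klE0 n / 2) ^ 2 → f s = 0) (hout : ∀ s, (4 * klScale klE0 n) ^ 2 ≤ s → f s = 0)
    (hK' : 0 ≤ K') (hΨlip : ∀ k₀ e k₀' e', ‖klfb_prop f' k₀ e - klfb_prop f' k₀' e'‖ ≤ K' * (|k₀ - k₀'| + |e - e'|))
    (hMF : 0 ≤ MF) (hFlip : ∀ s s', ‖f s * f' s - f s' * f' s'‖ ≤ LF * |s - s'|) (hFbd : ∀ s, ‖f s * f' s‖ ≤ MF)
    (hLF : LF ≤ ℓ / klScale klE0 n ^ 2)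
    (hW : ContinuousOn W (Icc (-(4 * klScale klE0 n)) (4 * klScale klE0 n))) (hLW : 0 ≤ LW) (hBW : 0 ≤ BW)
    (hWlip : ∀ e : ℝ, |e| < 4 * klScale klE0 n → ‖W e - W 0‖ ≤ LW * |e|)
    (hWbd : ∀ e, |e| < 4 * klScale klE0 n → ‖W e‖ ≤ BW)
    (hσc : ContinuousOn σ (Icc (-(4 * klScale klE0 n)) (4 * klScale klE0 n))) (hδ0 : 0 ≤ δmax)
    (hσ : ∀ e, |e| ≤ 4 * klScale klE0 n → |σ e| ≤ δmax)
    (q₀ : ℝ) {β : ℝ} (hβ : klBetaMin ≤ β) (hn : n ≤ nScales β + 1) {M : ℕ}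
    (hM : β * (4 * klScale klE0 n) / (2 * Real.pi) + 1 ≤ M) :
    ‖β⁻¹ • ∑ i : MatsubaraIdx M, ∫ e,
        W e * klfb_prop f (matsubaraFreq β M i) e * klfb_prop f' (matsubaraFreq β M i + q₀) (e + σ e)‖ ≤
      524288 / Real.pi * (ℓ + 8 * MF) * LW * klScale klE0 n +
        393216 / Real.pi * (ℓ + 8 * MF) * BW * ((Real.pi / β) / klScale klE0 n) +
          256 / Real.pi * Mf * BW * (K' * klScale klE0 n) * (|q₀| + δmax) := by
  set r := 4 * klScale klE0 n with hr_def
  have hΛ := klth_klScale_pos n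
  have hr : 0 ≤ r := by positivity
  set W' : ℝ → ℂ := fun e => W (max (-r) (min r e)) with hW'
  set σ' : ℝ → ℝ := fun e => σ (max (-r) (min r e)) with hσ'
  have hW'c : Continuous W' := klsw_continuous_comp_clamp hr hW
  have hσ'c : Continuous σ' := klsw_continuous_comp_clamp hr hσc
  have hW'eq : ∀ e, |e| < r → W' e = W e := fun e he => by simp only [hW', Literature.Analysis.FunctionSpaces.max_neg_min_eq_self he.le]
  have hσ'eq : ∀ e, |e| < r → σ' e = σ e := fun e he => by simp only [hσ', Literature.Analysis.FunctionSpaces.max_neg_min_eq_self he.le]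
  have hW'0 : W' 0 = W 0 := by
    simp only [hW', Literature.Analysis.FunctionSpaces.max_neg_min_eq_self (show |(0:ℝ)| ≤ r by simpa using hr)]
  have hW'lip : ∀ e : ℝ, |e| < r → ‖W' e - W' 0‖ ≤ LW * |e| := fun e he => by rw [hW'eq e he, hW'0]; exact hWlip e he
  have hW'bd : ∀ e : ℝ, |e| < r → ‖W' e‖ ≤ BW := fun e he => by rw [hW'eq e he]; exact hWbd e he
  have hσ'bd : ∀ e, |σ' e| ≤ δmax := fun e =>
    hσ _ (abs_le.mpr ⟨(klsw_clamp_mem hr e).1, (klsw_clamp_mem hr e).2⟩)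
  have hΦzero : ∀ (k₀ e : ℝ), r ≤ |e| → klfb_prop f k₀ e = 0 := fun k₀ e he => klfb_prop_eq_zero_of_le_abs hr hout k₀ he
  have hpt : ∀ (k₀ e : ℝ), W e * klfb_prop f k₀ e * klfb_prop f' (k₀ + q₀) (e + σ e) =
      W' e * klfb_prop f k₀ e * klfb_prop f' (k₀ + q₀) (e + σ' e) := by
    intro k₀ e
    by_cases he : |e| < r
    · rw [hW'eq e he, hσ'eq e he]
    · rw [hΦzero k₀ e (not_lt.mp he), mul_zero, zero_mul, mul_zero, zero_mul]
  simp_rw [hpt]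
  exact klfs_transfer_norm_le_of_lipschitz_core hlip hbd hin hout hK' hΨlip hMF hFlip hFbd hLF hW'c hLW hBW hW'lip hW'bd hσ'c hδ0
    hσ'bd q₀ hβ hn hM
end Transfer

/-! ## §3 On the frame band: per-ray and planar bounds with the second line given by its joint Lipschitz constant -/

section Frame
variable {a b : ℝ} (B : BandBounds a b) {δ : (Fin 2 → ℝ) → ℝ} (hδ1 : ContDiff ℝ 1 δ) {κ₀ κ₁ : ℝ}
  (hδ : ∀ k : Fin 2 → ℝ, (∀ i, |k i| ≤ π) → |δ k| ≤ κ₀)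
  (hκ : ∀ k : Fin 2 → ℝ, (∀ i, |k i| ≤ π) → ‖fderiv ℝ δ k‖ ≤ κ₁) (hκ₁ : κ₁ < B.Dtmin)

omit B in
/-- Continuity of the forward-bubble integrand when the second propagator is jointly Lipschitz. -/
theorem klfs_continuous_integrand (hδc : Continuous δ) {A : ℝ × ℝ → ℂ} (hA : Continuous A) {f f' : ℝ → ℂ} {Lf Mf r₁ r₂ K' : ℝ}
    (hlip : ∀ s s', ‖f s - f s'‖ ≤ Lf * |s - s'|) (hbd : ∀ s, ‖f s‖ ≤ Mf) (hin : ∀ s, s ≤ r₁ ^ 2 → f s = 0)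
    (hout : ∀ s, r₂ ^ 2 ≤ s → f s = 0) (hr₁ : 0 < r₁) (hr₂ : 0 < r₂)
    (hΨlip : ∀ k₀ e k₀' e', ‖klfb_prop f' k₀ e - klfb_prop f' k₀' e'‖ ≤ K' * (|k₀ - k₀'| + |e - e'|))
    {e' : ℝ × ℝ → ℝ} (he' : Continuous e') (μ k₀ q₀ : ℝ) :
    Continuous (klfb_integrand δ μ A f f' e' k₀ q₀) := by
  unfold klfb_integrand
  exact (hA.mul ((klfb_continuous_prop_snd hlip hbd hin hout hr₁ hr₂ k₀).comp (klfb_continuous_band hδc μ))).mul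
    ((klfs_continuous_snd_of_lipschitz hΨlip (k₀ + q₀)).comp he')

include B hδ1 hδ hκ hκ₁ in
/-- **The forward bubble on one ray in level coordinates** (second line by joint Lipschitz constant): as `klfb_ray_bubble_integral_eq`. -/
theorem klfs_ray_bubble_integral_eq {A : ℝ × ℝ → ℂ} (hA : Continuous A) (hAsupp : ∀ p : ℝ × ℝ, A p ≠ 0 → |p.1| < π ∧ |p.2| < π)
    {f f' : ℝ → ℂ} {Lf Mf r₁ r K' : ℝ}
    (hlip : ∀ s s', ‖f s - f s'‖ ≤ Lf * |s - s'|) (hbd : ∀ s, ‖f s‖ ≤ Mf) (hin : ∀ s, s ≤ r₁ ^ 2 → f s = 0)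
    (hout : ∀ s, r ^ 2 ≤ s → f s = 0) (hr₁ : 0 < r₁) (hr : 0 < r)
    (hΨlip : ∀ k₀ e k₀' e', ‖klfb_prop f' k₀ e - klfb_prop f' k₀' e'‖ ≤ K' * (|k₀ - k₀'| + |e - e'|))
    {e' : ℝ × ℝ → ℝ} (he' : Continuous e') {μ : ℝ} (hlo : a < μ - r - κ₀) (hhi : μ + r + κ₀ < b) (k₀ q₀ θ : ℝ) :
    ∫ t in Ioi (0 : ℝ), t • klfb_integrand δ μ A f f' e' k₀ q₀ (t * Real.cos θ, t * Real.sin θ) =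
      ∫ e : ℝ, klfb_weight δ μ A θ e * klfb_prop f k₀ e * klfb_prop f' (k₀ + q₀) (e + klfb_shift δ μ e' θ e) := by
  have hδc : Continuous δ := hδ1.continuous
  have hc := klfs_continuous_integrand hδc hA hlip hbd hin hout hr₁ hr hΨlip he' μ k₀ q₀
  rw [klfb_ray_integral_eq B hδ1 hδ hκ hκ₁ hc hr.le hlo hhi (klfb_integrand_support hAsupp hr.le hout e' μ k₀ q₀) θ]
  have hwin : ∀ e ∈ uIcc (-r) r, klfb_jac δ μ θ e • klfb_integrand δ μ A f f' e' k₀ q₀ (klfb_rayPt δ μ θ e) =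
      klfb_weight δ μ A θ e * klfb_prop f k₀ e * klfb_prop f' (k₀ + q₀) (e + klfb_shift δ μ e' θ e) := by
    intro e he
    rw [uIcc_of_le (by linarith)] at he
    have hlo' : a ≤ μ + e - κ₀ := by linarith [he.1]
    have hhi' : μ + e + κ₀ ≤ b := by linarith [he.2]
    unfold klfb_integrand klfb_weight klfb_shift
    rw [klfb_band_rayPt B hδ hδc hlo' hhi' θ, add_sub_cancel, Complex.real_smul]
    ring
  rw [intervalIntegral.integral_congr hwin]
  refine intervalIntegral.integral_eq_integral_of_support_subset fun e he => ?_
  by_contra hnot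
  apply he
  have hge : r ≤ |e| := by
    by_contra hlt
    push Not at hlt
    exact hnot ⟨by linarith [neg_abs_le e], (le_abs_self e).trans hlt.le⟩
  simp only [klfb_prop_eq_zero_of_le_abs hr.le hout k₀ hge, mul_zero, zero_mul]

include B hδ1 hδ hκ hκ₁ in
/-- **THE FORWARD SLICE BUBBLE ON ONE RAY, second line by its joint Lipschitz constant `K'`** (zero-sound remainder + thermal layer + shift):
as `klfb_ray_bubble_norm_le` with the `f'`-hypotheses replaced by `hΨlip` and the shift term `(256/π)·M_f·B_W·(K'Λ_n)·(|q₀| + δ_max)`. -/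
theorem klfs_ray_bubble_norm_le_of_lipschitz {A : ℝ × ℝ → ℂ} (hA : Continuous A)
    (hAsupp : ∀ p : ℝ × ℝ, A p ≠ 0 → |p.1| < π ∧ |p.2| < π) {A₀ A₁ : ℝ} (hA0 : ∀ p, ‖A p‖ ≤ A₀)
    (hA1 : ∀ θ t t' : ℝ, 0 ≤ t → 0 ≤ t' →
      ‖A (t * Real.cos θ, t * Real.sin θ) - A (t' * Real.cos θ, t' * Real.sin θ)‖ ≤ A₁ * |t - t'|)
    {κ₂ : ℝ} (hκ₂ : 0 ≤ κ₂)
    (hD2 : ∀ θ s t : ℝ, s ∈ Icc 0 (π / ‖dir θ‖) → t ∈ Icc 0 (π / ‖dir θ‖) →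
      |fderiv ℝ δ (s • dir θ) (dir θ) - fderiv ℝ δ (t • dir θ) (dir θ)| ≤ κ₂ * |s - t|)
    {f f' : ℝ → ℂ} {Lf Mf K' LF MF ℓ : ℝ} {n : ℕ}
    (hlip : ∀ s s', ‖f s - f s'‖ ≤ Lf * |s - s'|) (hbd : ∀ s, ‖f s‖ ≤ Mf)
    (hin : ∀ s, s ≤ (klScale klE0 n / 2) ^ 2 → f s = 0) (hout : ∀ s, (4 * klScale klE0 n) ^ 2 ≤ s → f s = 0)
    (hK' : 0 ≤ K') (hΨlip : ∀ k₀ e k₀' e', ‖klfb_prop f' k₀ e - klfb_prop f' k₀' e'‖ ≤ K' * (|k₀ - k₀'| + |e - e'|))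
    (hMF : 0 ≤ MF) (hFlip : ∀ s s', ‖f s * f' s - f s' * f' s'‖ ≤ LF * |s - s'|) (hFbd : ∀ s, ‖f s * f' s‖ ≤ MF)
    (hLF : LF ≤ ℓ / klScale klE0 n ^ 2)
    {e' : ℝ × ℝ → ℝ} (he' : Continuous e') {μ δmax : ℝ} (hδ0 : 0 ≤ δmax)
    (he'δ : ∀ p : ℝ × ℝ, |p.1| < π → |p.2| < π → |e' p - klfb_band δ μ p| ≤ δmax)
    (hlo : a < μ - 4 * klScale klE0 n - κ₀) (hhi : μ + 4 * klScale klE0 n + κ₀ < b)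
    (q₀ : ℝ) {β : ℝ} (hβ : klBetaMin ≤ β) (hn : n ≤ nScales β + 1) {M : ℕ}
    (hM : β * (4 * klScale klE0 n) / (2 * Real.pi) + 1 ≤ M) (θ : ℝ) :
    ‖β⁻¹ • ∑ i : MatsubaraIdx M, ∫ t in Ioi (0 : ℝ),
        t • klfb_integrand δ μ A f f' e' (matsubaraFreq β M i) q₀ (t * Real.cos θ, t * Real.sin θ)‖ ≤
      524288 / Real.pi * (ℓ + 8 * MF) *
          (Real.pi * Real.sqrt 2 / (B.Dtmin - κ₁) * A₁ / (B.Dtmin - κ₁) +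
            A₀ * (1 / (B.Dtmin - κ₁) ^ 2 + Real.pi * Real.sqrt 2 * (2 + κ₂) / (B.Dtmin - κ₁) ^ 3)) * klScale klE0 n +
        393216 / Real.pi * (ℓ + 8 * MF) * (A₀ * (Real.pi * Real.sqrt 2 / (B.Dtmin - κ₁))) * ((Real.pi / β) / klScale klE0 n) +
          256 / Real.pi * Mf * (A₀ * (Real.pi * Real.sqrt 2 / (B.Dtmin - κ₁))) * (K' * klScale klE0 n) * (|q₀| + δmax) := by
  have hδc : Continuous δ := hδ1.continuous
  have hΛ := klth_klScale_pos n
  have hr₁ : 0 < klScale klE0 n / 2 := by positivity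
  have hr : 0 < 4 * klScale klE0 n := by positivity
  have hd : 0 < B.Dtmin - κ₁ := by linarith
  have hA0' : 0 ≤ A₀ := (norm_nonneg _).trans (hA0 0)
  have hA1' : 0 ≤ A₁ := klfb_radialLip_nonneg hA1
  have hκ₀ : 0 ≤ κ₀ := (abs_nonneg _).trans (hδ 0 (fun i => by simp [Real.pi_pos.le]))
  have hμlo : a ≤ μ - κ₀ := by linarith
  have hμhi : μ + κ₀ ≤ b := by linarith
  have hray : ∀ i : MatsubaraIdx M, ∫ t in Ioi (0 : ℝ),
      t • klfb_integrand δ μ A f f' e' (matsubaraFreq β M i) q₀ (t * Real.cos θ, t * Real.sin θ) =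
        ∫ e : ℝ, klfb_weight δ μ A θ e * klfb_prop f (matsubaraFreq β M i) e *
          klfb_prop f' (matsubaraFreq β M i + q₀) (e + klfb_shift δ μ e' θ e) := fun i =>
    klfs_ray_bubble_integral_eq B hδ1 hδ hκ hκ₁ hA hAsupp hlip hbd hin hout hr₁ hr hΨlip he' hlo hhi _ q₀ θ
  rw [Finset.sum_congr rfl fun i _ => hray i]
  have hW : ContinuousOn (klfb_weight δ μ A θ) (Icc (-(4 * klScale klE0 n)) (4 * klScale klE0 n)) :=
    klfb_weight_continuousOn B hδ1 hδ hκ hκ₁ hA hlo hhi θ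
  have hWlip : ∀ e : ℝ, |e| < 4 * klScale klE0 n → ‖klfb_weight δ μ A θ e - klfb_weight δ μ A θ 0‖ ≤
      (Real.pi * Real.sqrt 2 / (B.Dtmin - κ₁) * A₁ / (B.Dtmin - κ₁) +
          A₀ * (1 / (B.Dtmin - κ₁) ^ 2 + Real.pi * Real.sqrt 2 * (2 + κ₂) / (B.Dtmin - κ₁) ^ 3)) * |e| := by
    intro e he
    exact klfb_weight_sub_zero_norm_le B hδ1 hδ hκ hκ₁ hA0 hA1 hκ₂ (hD2 θ) hμlo hμhi (by linarith [(abs_lt.mp he).1])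
      (by linarith [(abs_lt.mp he).2])
  have hWbd : ∀ e : ℝ, |e| < 4 * klScale klE0 n → ‖klfb_weight δ μ A θ e‖ ≤ A₀ * (Real.pi * Real.sqrt 2 / (B.Dtmin - κ₁)) := by
    intro e he
    exact klfb_weight_norm_le B hδ hκ hκ₁ hδc hA0 (by linarith [(abs_lt.mp he).1]) (by linarith [(abs_lt.mp he).2]) θ
  have hσc : ContinuousOn (klfb_shift δ μ e' θ) (Icc (-(4 * klScale klE0 n)) (4 * klScale klE0 n)) :=
    klfb_shift_continuousOn B hδ1 hδ hκ hκ₁ he' hlo hhi θ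
  have hσ : ∀ e : ℝ, |e| ≤ 4 * klScale klE0 n → |klfb_shift δ μ e' θ e| ≤ δmax := by
    intro e he
    exact klfb_shift_abs_le B hδ hδc he'δ (by linarith [(abs_le.mp he).1]) (by linarith [(abs_le.mp he).2]) θ
  have hLW : 0 ≤ Real.pi * Real.sqrt 2 / (B.Dtmin - κ₁) * A₁ / (B.Dtmin - κ₁) +
      A₀ * (1 / (B.Dtmin - κ₁) ^ 2 + Real.pi * Real.sqrt 2 * (2 + κ₂) / (B.Dtmin - κ₁) ^ 3) := by positivity
  have hBW : 0 ≤ A₀ * (Real.pi * Real.sqrt 2 / (B.Dtmin - κ₁)) := by positivity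
  exact klfs_transfer_norm_le_of_lipschitz hlip hbd hin hout hK' hΨlip hMF hFlip hFbd hLF hW hLW hBW hWlip hWbd hσc hδ0 hσ q₀ hβ hn hM

include B hδ1 hδ hκ hκ₁ in
/-- **THE FORWARD SLICE BUBBLE OF THE FRAME BAND ON THE PLANE, second line by its joint Lipschitz constant `K'`**: as
`klfb_planar_bubble_norm_le` with the shift term `(256/π)·M_f·B_W·(K'Λ_n)·(|q₀| + δ_max)` (times `2π` from the angle). -/
theorem klfs_planar_bubble_norm_le_of_lipschitz {A : ℝ × ℝ → ℂ} (hA : Continuous A)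
    (hAsupp : ∀ p : ℝ × ℝ, A p ≠ 0 → |p.1| < π ∧ |p.2| < π) {A₀ A₁ : ℝ} (hA0 : ∀ p, ‖A p‖ ≤ A₀)
    (hA1 : ∀ θ t t' : ℝ, 0 ≤ t → 0 ≤ t' →
      ‖A (t * Real.cos θ, t * Real.sin θ) - A (t' * Real.cos θ, t' * Real.sin θ)‖ ≤ A₁ * |t - t'|)
    {κ₂ : ℝ} (hκ₂ : 0 ≤ κ₂)
    (hD2 : ∀ θ s t : ℝ, s ∈ Icc 0 (π / ‖dir θ‖) → t ∈ Icc 0 (π / ‖dir θ‖) →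
      |fderiv ℝ δ (s • dir θ) (dir θ) - fderiv ℝ δ (t • dir θ) (dir θ)| ≤ κ₂ * |s - t|)
    {f f' : ℝ → ℂ} {Lf Mf K' LF MF ℓ : ℝ} {n : ℕ}
    (hlip : ∀ s s', ‖f s - f s'‖ ≤ Lf * |s - s'|) (hbd : ∀ s, ‖f s‖ ≤ Mf)
    (hin : ∀ s, s ≤ (klScale klE0 n / 2) ^ 2 → f s = 0) (hout : ∀ s, (4 * klScale klE0 n) ^ 2 ≤ s → f s = 0)
    (hK' : 0 ≤ K') (hΨlip : ∀ k₀ e k₀' e', ‖klfb_prop f' k₀ e - klfb_prop f' k₀' e'‖ ≤ K' * (|k₀ - k₀'| + |e - e'|))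
    (hMF : 0 ≤ MF) (hFlip : ∀ s s', ‖f s * f' s - f s' * f' s'‖ ≤ LF * |s - s'|) (hFbd : ∀ s, ‖f s * f' s‖ ≤ MF)
    (hLF : LF ≤ ℓ / klScale klE0 n ^ 2)
    {e' : ℝ × ℝ → ℝ} (he' : Continuous e') {μ δmax : ℝ} (hδ0 : 0 ≤ δmax)
    (he'δ : ∀ p : ℝ × ℝ, |p.1| < π → |p.2| < π → |e' p - klfb_band δ μ p| ≤ δmax)
    (hlo : a < μ - 4 * klScale klE0 n - κ₀) (hhi : μ + 4 * klScale klE0 n + κ₀ < b)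
    (q₀ : ℝ) {β : ℝ} (hβ : klBetaMin ≤ β) (hn : n ≤ nScales β + 1) {M : ℕ}
    (hM : β * (4 * klScale klE0 n) / (2 * Real.pi) + 1 ≤ M) :
    ‖β⁻¹ • ∑ i : MatsubaraIdx M, ∫ p : ℝ × ℝ, klfb_integrand δ μ A f f' e' (matsubaraFreq β M i) q₀ p‖ ≤
      2 * Real.pi *
        (524288 / Real.pi * (ℓ + 8 * MF) *
            (Real.pi * Real.sqrt 2 / (B.Dtmin - κ₁) * A₁ / (B.Dtmin - κ₁) +
              A₀ * (1 / (B.Dtmin - κ₁) ^ 2 + Real.pi * Real.sqrt 2 * (2 + κ₂) / (B.Dtmin - κ₁) ^ 3)) * klScale klE0 n +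
          393216 / Real.pi * (ℓ + 8 * MF) * (A₀ * (Real.pi * Real.sqrt 2 / (B.Dtmin - κ₁))) * ((Real.pi / β) / klScale klE0 n) +
            256 / Real.pi * Mf * (A₀ * (Real.pi * Real.sqrt 2 / (B.Dtmin - κ₁))) * (K' * klScale klE0 n) * (|q₀| + δmax)) := by
  have hδc : Continuous δ := hδ1.continuous
  have hΛ := klth_klScale_pos n
  have hr₁ : 0 < klScale klE0 n / 2 := by positivity
  have hr : 0 < 4 * klScale klE0 n := by positivity
  have hcs := klfb_hasCompactSupport_of_square hAsupp
  have hint : ∀ i : MatsubaraIdx M, Integrable (klfb_integrand δ μ A f f' e' (matsubaraFreq β M i) q₀) := by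
    intro i
    have hc := klfs_continuous_integrand hδc hA hlip hbd hin hout hr₁ hr hΨlip he' μ (matsubaraFreq β M i) q₀
    refine hc.integrable_of_hasCompactSupport ?_
    unfold klfb_integrand
    exact (hcs.mul_right).mul_right
  exact klry_norm_smul_sum_integral_le_of_ray_bound hint fun θ _ =>
    klfs_ray_bubble_norm_le_of_lipschitz B hδ1 hδ hκ hκ₁ hA hAsupp hA0 hA1 hκ₂ hD2 hlip hbd hin hout hK' hΨlip hMF hFlip hFbd hLF he'
      hδ0 he'δ hlo hhi q₀ hβ hn hM θ
end Frame

end Summit.HubbardSuperconductivity.HubbardSuperconductivity.Theorems.KLRegimeSplit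

end
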